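/-
Free seat `ym-line-cbag-p1` LEAD (prover-ym-line-cbag-p1-g5-0; own items 22254 `BoxFloorAllGroups` / 22893 `ExpChartPackage2` closed), route
`ColdBoxAllGroups`, helping crux `BulkAllGroups` (stmt-QuantumFields-22255), line `dlr-chessboard-G` (lead `ym-line-cbag-p2`): the A-mean core
INSTANTIATED with the ϑ-datum trunk, representation and Gaussian sandwich kept as hypotheses — G-port of
`…BulkDominatesColdBoxWKernelMeanTrunk.abs_kernelMean_sub_le_of_trunk` in the style of the box line's «CoreG».
-/
import Summits.QuantumFields.YangMills.Theorems.ColdBoxAllGroupsBulkAllGroupsKernelMeanCore2G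
import Summits.QuantumFields.YangMills.Theorems.ColdBoxAllGroupsBulkAllGroupsTiltBoundDatumG
import Summits.QuantumFields.YangMills.Theorems.ColdBoxAllGroupsBulkAllGroupsRepresentationDatumGSteps
import Summits.QuantumFields.YangMills.Theorems.ColdBoxAllGroupsBoxFloorAllGroupsChartWindowG
import Summits.QuantumFields.YangMills.Theorems.ColdBoxAllGroupsBoxFloorAllGroupsCoreG

/-!
# Crux `BulkAllGroups` (stmt-QuantumFields-22255), stub `stub_kernelMeanExpansionG`: the mean core instantiated with the datum trunk
# (deterministic form, any compact `G` presented in `U(N)`, `D = dimE ρ` colours, exponential chart)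

`abs_kernelMeanG_sub_gaussian_le_core₂` (`…KernelMeanCore2G`, lead p2) bounds `|β·E_{γ(·|W)} c_q − ((D/2)C_D(q,q) + ½Σ_c F_c²)|` in terms of a
representation identity, a tilt bound, the on-`S` bound and linearisation error of the observable, and the two bad masses.  This file
DISCHARGES the observable-side hypotheses with the landed datum trunk — R3 with datum `abs_beta_mul_plaqCostAt_sub_qObsDE_le` and T4
`abs_tiltWDE_le` (w2, `…TiltBoundDatumG`), `beta_mul_plaqCostAt_mem_Icc_of_mem_goodTDE`, the units identity `qObsDE_eq_half_sum_sq`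
(`…OneScaleDatumDefsG`) — on the good event
`S = goodTDE ρ H β ε ϑ ∩ {t | ∀ e, ‖unscaleTE H D β (t + μ') e‖ ≤ m}` (`μ' = meanTE H D β ϑ`; on `S` every chart coordinate of `cfgTDE t` is
`≤ m` once the exterior datum is `≤ r ≤ m`, `norm_extDatum_le_of_window`), keeping as HYPOTHESES, exactly as the box line's «CoreG» does:
the representation `hrep` (T3 with datum, `…RepresentationDatumG`: `∫ X dγ(·|W)[|coldGoodSetG] = ∫ X(cfgTDE t) d((gaussD[|S]).tilted (𝟙_S·tiltWDE))`
for measurable gauge-invariant `X ≥ 0`), the Gaussian sandwich `gaussD(Sᶜ) ≤ p ≤ 1/2` (`…SmallFieldGoodTDG`), the YM rarity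
`γ(·|W)(coldGoodSetGᶜ) ≤ pY < 1`, and the chart density's log bound `|log g| ≤ ℓ` on `‖a‖ ≤ m`:

**`abs_kernelMeanG_sub_le_of_trunk`** — for every plaquette `q = (x; i<j)` touching the cold box,
`|β·E_{γ(·|W)} c_q − ((D/2)·C_D(q,q) + ½Σ_c F'_c(q)²)| ≤ 2(2Nβ)·pY + β^{2ε}(e^{2w} − 1) + 190βm³ + 2(1 + 2DΣ_c(F'_c(q)⁴ + 3C_D(q,q)²))·√p`,
`F'_c = sCirc (glue ϑ'_c (mean ϑ'_c))`, `ϑ' = sdatE β ϑ = √β•ϑ`, `w = #(plaquettesTouching Λ)·190βm³ + #(ColdFreeIdx H)·ℓ`.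
No sorry; no new definition; standard axioms.  NOT a claim about the mass gap: rung-level support (R2xi-G `XiPow`, RECORD label); the Yang–Mills
mass gap is NOT proved by any of this.
-/

set_option autoImplicit false

noncomputable section

open MeasureTheory ProbabilityTheory Finset
open Literature.Probability.LatticeModels (Site)
open Literature.MathematicalPhysics.QuantumLattice
open Literature.MathematicalPhysics.QuantumFieldTheory
open Literature.MathematicalPhysics.QuantumFieldTheory.LatticeMaxwell
open Literature.MathematicalPhysics.QuantumFieldTheory.AxialGauge
open Summit.QuantumFields.YangMills.Theorems.WeakCouplingRates
open Summit.QuantumFields.YangMills.Theorems.FreeEnergyLogCoefficient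

namespace Summit.QuantumFields.YangMills.Theorems.ColdBoxAllGroups

variable {H N : ℕ} {G : Type} [Group G] (ρ : G →* Matrix (Fin N) (Fin N) ℂ)

/-- **Every chart coordinate is `≤ m` inside the window.**  If the exterior datum has `Σ_c ϑ_{c,e}² ≤ r²` off the cold box with `0 ≤ r ≤ m`
and the free-link data satisfy `‖w e‖ ≤ m`, then every coordinate `extDatum (datVec ϑ) w e` has norm `≤ m` (forest coordinates are `0`). -/
theorem norm_extDatum_le_of_window (ϑ : Fin (dimE ρ) → (Literature.MathematicalPhysics.QuantumLattice.ZdEdge 4 → ℝ))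
    (w : ColdFreeIdx H → EuclideanSpace ℝ (Fin (dimE ρ))) {r m : ℝ} (hr : 0 ≤ r) (hrm : r ≤ m)
    (hϑ : ∀ e, e ∉ boxEdges 4 (2 * H + 1) → ∑ c, ϑ c e ^ 2 ≤ r ^ 2)
    (hw : ∀ e, ‖w e‖ ≤ m) (e : Literature.MathematicalPhysics.QuantumLattice.ZdEdge 4) :
    ‖extDatum (datVec ϑ) w e‖ ≤ m := by
  by_cases hΛ : e ∈ boxEdges 4 (2 * H + 1)
  · by_cases hf : (e.2 = 0 ∧ ∀ k : Fin 4, 1 ≤ e.1 k ∧ e.1 k + 1 ≤ 2 * (H : ℤ))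
    · obtain ⟨x, j⟩ := e
      obtain ⟨hj, hx⟩ := hf
      simp only at hj hx
      subst hj
      rw [extDatum_of_forest _ _ hx, norm_zero]; exact hr.trans hrm
    · have := extDatum_apply_free (datVec ϑ) w ⟨⟨e, hΛ⟩, hf⟩
      rw [this]; exact hw _
  · rw [extDatum_of_not_mem _ _ hΛ]
    exact (norm_datVec_le ϑ hr (hϑ e hΛ)).trans hrm

variable [TopologicalSpace G] [IsTopologicalGroup G] [CompactSpace G] [MeasurableSpace G] [BorelSpace G] [SecondCountableTopology G]

/-- **The A-mean core instantiated with the ϑ-datum trunk (deterministic form), any compact `G`.**  See the module docstring: `hrep` is the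
representation T3 with datum, `hpS`/`hp2` the Gaussian sandwich, `hbad`/`hpY1` the YM rarity, `hg` the chart density's log bound; the exterior
datum is `≤ r ≤ m ≤ 1/4` off the cold box and vanishes on the temporal forest. -/
theorem abs_kernelMeanG_sub_le_of_trunk (hρ : Continuous ρ) (hinj : Function.Injective ρ)
    (hρu : ∀ g, ρ g ∈ Matrix.unitaryGroup (Fin N) ℂ) {β ε r m ℓ p pY : ℝ}
    {g : EuclideanSpace ℝ (Fin (dimE ρ)) → ℝ} (hgm : Measurable g)
    (hβ : 0 < β) (hr : 0 ≤ r) (hrm : r ≤ m) (hm4 : m ≤ 1 / 4) (hℓ : 0 ≤ ℓ)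
    (hg : ∀ a, ‖a‖ ≤ m → |Real.log (g a)| ≤ ℓ)
    {W : LGConfig 4 G} {ϑ : Fin (dimE ρ) → Literature.MathematicalPhysics.QuantumLattice.ZdEdge 4 → ℝ}
    (hϑ : ∀ e, e ∉ boxEdges 4 (2 * H + 1) → ∑ c, ϑ c e ^ 2 ≤ r ^ 2)
    (hforest : ∀ x : Site 4, (∀ k : Fin 4, 1 ≤ x k ∧ x k + 1 ≤ 2 * (H : ℤ)) → ∀ c, ϑ c (x, 0) = 0)
    (hbad : (boxKernelG ρ β H W).real (coldGoodSetG ρ H β ε)ᶜ ≤ pY) (hpY1 : pY < 1)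
    (hpS : (gaussD H (dimE ρ)).real
        (goodTDE ρ H β ε ϑ ∩ {t | ∀ e, ‖unscaleTE H (dimE ρ) β (t + meanTE H (dimE ρ) β ϑ) e‖ ≤ m})ᶜ ≤ p)
    (hp2 : p ≤ 1 / 2)
    (hrep : ∀ X : LGConfig 4 G → ℝ, Measurable X → IsZdGaugeInvariant X → (∀ U, 0 ≤ X U) →
      ∫ U, X U ∂((boxKernelG ρ β H W)[|coldGoodSetG ρ H β ε]) =
        ∫ t, X (cfgTDE ρ H β ϑ t)
          ∂(((gaussD H (dimE ρ))[|(goodTDE ρ H β ε ϑ ∩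
              {t | ∀ e, ‖unscaleTE H (dimE ρ) β (t + meanTE H (dimE ρ) β ϑ) e‖ ≤ m})]).tilted
            ((goodTDE ρ H β ε ϑ ∩ {t | ∀ e, ‖unscaleTE H (dimE ρ) β (t + meanTE H (dimE ρ) β ϑ) e‖ ≤ m}).indicator
              (tiltWDE ρ H g β ϑ))))
    {x : Site 4} {i j : Fin 4} (hij : i < j)
    (hx : ((x, ⟨(i, j), hij⟩) : ZdPlaquette 4) ∈ plaquettesTouching (boxEdges 4 (2 * H + 1))) :
    |β * (∫ U, plaqCostAt ρ x i j U ∂(boxKernelG ρ β H W)) -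
        ((dimE ρ : ℝ) / 2 * boxDirProjKernel H (x, i, j) (x, i, j) +
          1 / 2 * ∑ c, (sCirc (glue (pin := fun e => e ∉ dirFreeEdges H) dirCorner (2 * H + 3) (sdatE β ϑ c)
            (mean (fun e => e ∉ dirFreeEdges H) dirCorner (2 * H + 3) (sdatE β ϑ c))) (x, i, j)) ^ 2)| ≤
      2 * (2 * N * β) * pY +
        (β ^ (2 * ε) * (Real.exp (2 * ((#(plaquettesTouching (boxEdges 4 (2 * H + 1))) : ℝ) * (190 * β * m ^ 3) +
            (Fintype.card (ColdFreeIdx H) : ℝ) * ℓ)) - 1) + 190 * β * m ^ 3 +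
          2 * (1 + 2 * (dimE ρ : ℝ) * ∑ c, ((sCirc (glue (pin := fun e => e ∉ dirFreeEdges H) dirCorner (2 * H + 3) (sdatE β ϑ c)
            (mean (fun e => e ∉ dirFreeEdges H) dirCorner (2 * H + 3) (sdatE β ϑ c))) (x, i, j)) ^ 4 +
              3 * boxDirProjKernel H (x, i, j) (x, i, j) ^ 2)) * Real.sqrt p) := by
  -- abbreviations
  set Gd := coldGoodSetG ρ H β ε with hGdef
  set S : Set (TSpaceD H (dimE ρ)) :=
    goodTDE ρ H β ε ϑ ∩ {t | ∀ e, ‖unscaleTE H (dimE ρ) β (t + meanTE H (dimE ρ) β ϑ) e‖ ≤ m} with hSdef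
  set τ : ℝ := 190 * β * m ^ 3 with hτ
  set w : ℝ := (#(plaquettesTouching (boxEdges 4 (2 * H + 1))) : ℝ) * τ + (Fintype.card (ColdFreeIdx H) : ℝ) * ℓ with hw
  set F : Fin (dimE ρ) → ℝ := fun c => sCirc (glue (pin := fun e => e ∉ dirFreeEdges H) dirCorner (2 * H + 3) (sdatE β ϑ c)
    (mean (fun e => e ∉ dirFreeEdges H) dirCorner (2 * H + 3) (sdatE β ϑ c))) (x, i, j) with hF'
  have hm0 : 0 ≤ m := hr.trans hrm
  have hτ0 : 0 ≤ τ := by positivity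
  have hw0 : 0 ≤ w := by positivity
  -- the YM good event is charged
  haveI : IsProbabilityMeasure (boxKernelG ρ β H W) := isProbabilityMeasure_boxKernelG ρ hρ β H W
  have hGm : MeasurableSet Gd := measurableSet_coldGoodSetG ρ hρ β ε
  have hG0 : boxKernelG ρ β H W Gd ≠ 0 := measure_ne_zero_of_real_compl_lt_one _ hGm (hbad.trans_lt hpY1)
  -- the Gaussian good event is charged
  haveI : IsProbabilityMeasure (gaussD H (dimE ρ)) := isProbabilityMeasure_gaussD H (dimE ρ)
  have hSm : MeasurableSet S :=
    (measurableSet_goodTDE ρ hρ hinj β ε ϑ).inter (measurableSet_ball_unscaleTE_add (dimE ρ) β m _)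
  have hS0 : gaussD H (dimE ρ) S ≠ 0 :=
    measure_ne_zero_of_real_compl_lt_one _ hSm (hpS.trans_lt (by linarith))
  -- the observable `β·c_q`: measurable, gauge invariant, nonnegative, globally bounded by `2Nβ`
  have hXm : Measurable fun U : LGConfig 4 G => β * plaqCostAt ρ x i j U :=
    (measurable_plaqCostAt_of_continuous ρ hρ x i j).const_mul β
  have hXinv : IsZdGaugeInvariant fun U : LGConfig 4 G => β * plaqCostAt ρ x i j U :=
    isZdGaugeInvariant_const_mul_plaqCostAtG ρ β x i j
  have hX0 : ∀ U : LGConfig 4 G, 0 ≤ β * plaqCostAt ρ x i j U := fun U => by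
    refine mul_nonneg hβ.le ?_
    simp only [plaqCostAt, plaquetteObs]
    rw [Literature.MathematicalPhysics.QuantumFieldTheory.sub_re_trace_eq_half_norm_sub_one_sq (hρu _)]
    positivity
  have hfM : ∀ U : LGConfig 4 G, |β * plaqCostAt ρ x i j U| ≤ 2 * N * β := fun U => by
    rw [abs_mul, abs_of_pos hβ]
    have h := abs_plaqCostAt_leG ρ hρu x i j U
    nlinarith [abs_nonneg (plaqCostAt ρ x i j U)]
  -- T3: the representation
  have hRep := hrep _ hXm hXinv hX0
  -- on `S` every chart coordinate of `cfgTDE t` is `≤ m`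
  have ha : ∀ t ∈ S, ∀ e, ‖extDatum (datVec ϑ) (unscaleTE H (dimE ρ) β (t + meanTE H (dimE ρ) β ϑ)) e‖ ≤ m :=
    fun t ht e => norm_extDatum_le_of_window ρ ϑ _ hr hrm hϑ ht.2 e
  -- T4: the tilt bound (indicator form)
  have hWt : ∀ t, |S.indicator (tiltWDE ρ H g β ϑ) t| ≤ w := by
    intro t
    by_cases ht : t ∈ S
    · rw [Set.indicator_of_mem ht]
      exact abs_tiltWDE_le ρ hρ hβ hm4 hg hforest t (ha t ht)
    · rw [Set.indicator_of_notMem ht, abs_zero]; exact hw0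
  -- on-`S` bound and linearisation (R3 with datum + the units identity)
  have hFS : ∀ t ∈ S, |β * plaqCostAt ρ x i j (cfgTDE ρ H β ϑ t)| ≤ β ^ (2 * ε) := by
    intro t ht
    obtain ⟨h0, h1⟩ := beta_mul_plaqCostAt_mem_Icc_of_mem_goodTDE ρ hρu hβ ht.1 hx
    rw [abs_of_nonneg h0]; exact h1
  have hSur : ∀ t ∈ S, |β * plaqCostAt ρ x i j (cfgTDE ρ H β ϑ t) - 1 / 2 * ∑ c, (F c + dirCirc H (x, i, j) (t c)) ^ 2| ≤ τ := by
    intro t ht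
    have h := abs_beta_mul_plaqCostAt_sub_qObsDE_le ρ hρ hβ hm4 hforest t (ha t ht) hx
    rw [qObsDE_eq_half_sum_sq] at h
    exact h
  -- the core
  have hcore := abs_kernelMeanG_sub_gaussian_le_core₂ ρ hρ W x i j hGm hG0 hbad (M₀ := 2 * N * β) (M := β ^ (2 * ε))
    (Real.rpow_nonneg hβ.le _) hfM (cfgTDE ρ H β ϑ) (measurable_cfgTDE ρ hρ hinj β ϑ) hSm hS0 hpS hp2
    (measurable_tiltWDE ρ hρ hinj hgm β ϑ) hWt hRep F (x, i, j) hFS hSur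
  exact hcore

end Summit.QuantumFields.YangMills.Theorems.ColdBoxAllGroups

end
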